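/-
Origin: expansion seat `planner-pub-hodgecm-pv05-g2-0`, handover 2026-08-18T04:36:27Z (`HOME/pub-hodgecm-pv05-g2/lean/Pv05g2/KernelOperatorFDLinear.lean`, md5 9638ef5e, 106 lines);
landed by the gen-6 packager in gate run 22 as `HodgeCM/PerL34/KernelOperatorFDLinear.lean` (verbatim).
-/
/-
pub-hodgecm speedrun cell, prover pv05 — WIP module `Pv05.KernelOperatorFDLinear` (proposed landing place
`HodgeCM/PerL34/KernelOperatorFDLinear.lean`).  Imports: `Pv05.KernelOperatorFD` only (pv05, run-21 queue; the packager
rewrites the import to `HodgeCM.PerL34.KernelOperatorFD` — land AFTER it).  Mathlib otherwise.  Nothing posited/cited.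

# N21: `Φ ↦ 𝒯_Φ` is linear (tex l. 378–381) — kernel-side linearity of the FD operator

`θ_Φ` is linear in `Φ`, so the kernel `k_Φ(x,y) = θ_Φ(x,y)` is, and `𝒯_Φ = opT k_Φ` must be additive/homogeneous in
the kernel.  These are the by-name dischargers of the `ins_add` / `ins_smul` fields of pv06's `ArchCDatum` (D4/D7
instantiation, carver v4 §9 S4) at the L²-kernel shell level, FD model: `IsFDKernel.add`, `IsFDKernel.smul`,
`IsFDKernel.zero`, `integrable_kmul`, `evalT_add_kernel`, `evalT_smul_kernel`, `opT_add_kernel`, `opT_smul_kernel`,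
`opT_zero_kernel`, and `opT_congr` (the operator does not depend on the chosen bound `C`).
-/
import Summits.HodgeConjecture.HodgeCM.PerL34.KernelOperatorFD

/-! PORT of `HodgeCM/PerL34/KernelOperatorFDLinear.lean` (HodgeCMPerL run 81) — verbatim mechanical port; provenance in the PORT header line. -/

set_option autoImplicit false

noncomputable section

open MeasureTheory

namespace HodgeCM
namespace PerL34
namespace KernelOperatorFD

variable {X Y : Type*} [TopologicalSpace X] [MeasurableSpace Y]
  (ν : Measure Y) [IsFiniteMeasure ν] {k k₁ k₂ : X → Y → ℂ} {C C₁ C₂ : ℝ}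

/-- (Ported verbatim from the HodgeCMPerL package; no docstring in the source.) -/
theorem IsFDKernel.add (h₁ : IsFDKernel k₁ C₁) (h₂ : IsFDKernel k₂ C₂) :
    IsFDKernel (fun x y => k₁ x y + k₂ x y) (C₁ + C₂) where
  cont y := (h₁.cont y).add (h₂.cont y)
  meas x := (h₁.meas x).add (h₂.meas x)
  nonneg := add_nonneg h₁.nonneg h₂.nonneg
  bound x y := (norm_add_le _ _).trans (add_le_add (h₁.bound x y) (h₂.bound x y))

/-- (Ported verbatim from the HodgeCMPerL package; no docstring in the source.) -/
theorem IsFDKernel.smul (hk : IsFDKernel k C) (c : ℂ) : IsFDKernel (fun x y => c * k x y) (‖c‖ * C) where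
  cont y := continuous_const.mul (hk.cont y)
  meas x := (hk.meas x).const_mul c
  nonneg := mul_nonneg (norm_nonneg c) hk.nonneg
  bound x y := by rw [norm_mul]; exact mul_le_mul_of_nonneg_left (hk.bound x y) (norm_nonneg c)

/-- (Ported verbatim from the HodgeCMPerL package; no docstring in the source.) -/
theorem IsFDKernel.zero : IsFDKernel (fun (_ : X) (_ : Y) => (0 : ℂ)) 0 where
  cont _ := continuous_const
  meas _ := measurable_const
  nonneg := le_rfl
  bound _ _ := by simp

omit [TopologicalSpace X] in
/-- `y ↦ k(x,y) v(y)` is integrable for an FD kernel and `v ∈ L²(ν)` (bounded × integrable). -/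
theorem integrable_kmul [TopologicalSpace X] (hk : IsFDKernel k C) (v : Lp ℂ 2 ν) (x : X) :
    Integrable (fun y => k x y * v y) ν :=
  (integrable_of_Lp2 ν v).bdd_mul (hk.meas x).aestronglyMeasurable (ae_of_all ν fun y => hk.bound x y)

/-- (Ported verbatim from the HodgeCMPerL package; no docstring in the source.) -/
theorem evalT_add_kernel (h₁ : IsFDKernel k₁ C₁) (h₂ : IsFDKernel k₂ C₂) (v : Lp ℂ 2 ν) (x : X) :
    evalT (fun x y => k₁ x y + k₂ x y) ν v x = evalT k₁ ν v x + evalT k₂ ν v x := by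
  simp only [evalT_def, add_mul]
  exact integral_add (integrable_kmul ν h₁ v x) (integrable_kmul ν h₂ v x)

omit [TopologicalSpace X] [IsFiniteMeasure ν] in
/-- (Ported verbatim from the HodgeCMPerL package; no docstring in the source.) -/
theorem evalT_smul_kernel (c : ℂ) (v : Lp ℂ 2 ν) (x : X) :
    evalT (fun x y => c * k x y) ν v x = c * evalT k ν v x := by
  simp only [evalT_def, mul_assoc]
  exact integral_const_mul c _

section Compact

variable [FirstCountableTopology X] [CompactSpace X] [MeasurableSpace X] [BorelSpace X]
  (μ : Measure X) [IsFiniteMeasure μ]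

/-- The operator depends only on the kernel, not on the chosen bound. -/
theorem opT_congr {C' : ℝ} (hk : IsFDKernel k C) (hk' : IsFDKernel k C') : opT ν μ hk = opT ν μ hk' := rfl

/-- **Additivity in the kernel**: `𝒯_{k₁+k₂} = 𝒯_{k₁} + 𝒯_{k₂}` on `L²`. -/
theorem opT_add_kernel (h₁ : IsFDKernel k₁ C₁) (h₂ : IsFDKernel k₂ C₂) (v : Lp ℂ 2 ν) :
    opT ν μ (h₁.add h₂) v = opT ν μ h₁ v + opT ν μ h₂ v := by
  rw [opT_eq_toLp, opT_eq_toLp, opT_eq_toLp, ← map_add]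
  congr 1
  ext x
  rw [ContinuousMap.add_apply, evalTC_apply, evalTC_apply, evalTC_apply]
  exact evalT_add_kernel ν h₁ h₂ v x

/-- **Homogeneity in the kernel**: `𝒯_{c k} = c 𝒯_k` on `L²`. -/
theorem opT_smul_kernel (hk : IsFDKernel k C) (c : ℂ) (v : Lp ℂ 2 ν) :
    opT ν μ (hk.smul c) v = c • opT ν μ hk v := by
  rw [opT_eq_toLp, opT_eq_toLp, ← map_smul]
  congr 1
  ext x
  rw [ContinuousMap.smul_apply, smul_eq_mul, evalTC_apply, evalTC_apply]
  exact evalT_smul_kernel ν c v x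

/-- `𝒯_0 = 0`. -/
theorem opT_zero_kernel (v : Lp ℂ 2 ν) :
    opT ν μ (IsFDKernel.zero (X := X) (Y := Y)) v = 0 := by
  rw [opT_eq_toLp, ← map_zero (ContinuousMap.toLp (E := ℂ) 2 μ ℂ)]
  congr 1
  ext x
  rw [evalTC_apply, ContinuousMap.zero_apply]
  simp

end Compact

end KernelOperatorFD
end PerL34
end HodgeCM

end
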